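import Literature.MathematicalPhysics.QuantumLattice.WilsonDiracAP
import Summits.QuantumFields.QCD.Theorems.QuarksAsStableActionCriticalLineDiamagnetismStubHadamardUpper
import Summits.QuantumFields.QCD.Theorems.QuarksAsStableActionCriticalLineDiamagnetismStubFreeDetFormula
import Summits.QuantumFields.QCD.Theorems.QuarksAsStableActionCriticalLineDiamagnetismStubFreeSymbolSum
import Summits.QuantumFields.QCD.Theorems.QuarksAsStableActionCriticalLineDiamagnetismStubCellIncidence
import Summits.QuantumFields.QCD.Theorems.QuarksAsStableActionCriticalLineDiamagnetismStubQuarkChessboardOfSchwarz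
import Summits.QuantumFields.QCD.Theorems.QuarksAsStableActionCriticalLineDiamagnetismStubCellGainOfGauged
import Summits.QuantumFields.QCD.Theorems.QuarksAsStableActionCriticalLineDiamagnetismStubBlochFactorisation
import Summits.QuantumFields.QCD.Theorems.QuarksAsStableActionCriticalLineDiamagnetismStubFreeBlochBlocks
import Summits.QuantumFields.QCD.Theorems.QuarksAsStableActionCriticalLineDiamagnetismStubCellDetFactorisation
import Summits.QuantumFields.QCD.Theorems.QuarksAsStableActionCriticalLineDiamagnetismStubDetPerturbIR
import Summits.QuantumFields.QCD.Theorems.QuarksAsStableActionCriticalLineDiamagnetismStubLogDetSecondOrder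
import Summits.QuantumFields.QCD.Theorems.QuarksAsStableActionCriticalLineDiamagnetismStubDeltaBounds
import Summits.QuantumFields.QCD.Theorems.QuarksAsStableActionCriticalLineDiamagnetismStubBlochLatticeSum
import Summits.QuantumFields.QCD.Theorems.QuarksAsStableActionCriticalLineDiamagnetismStubTilingCellData
import Summits.QuantumFields.QCD.Theorems.QuarksAsStableActionCriticalLineDiamagnetismStubCellGainTilingGlue
import Summits.QuantumFields.QCD.Theorems.QuarksAsStableActionCriticalLineDiamagnetismStubBlockEstimate
import Summits.QuantumFields.QCD.Theorems.QuarksAsStableActionCriticalLineDiamagnetismStubCellGainCore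
import Summits.QuantumFields.QCD.Theorems.QuarksAsStableActionCriticalLineDiamagnetismStubCellRegauge
import Summits.QuantumFields.QCD.Theorems.QuarksAsStableActionCriticalLineDiamagnetismStubBackgroundSchwarz
import Summits.QuantumFields.QCD.Theorems.QuarksAsStableActionCriticalLineDiamagnetismStubTadpole
import Summits.QuantumFields.QCD.Theorems.QuarksAsStableActionCriticalLineDiamagnetismStubUnitaryCellIneq
import Summits.QuantumFields.QCD.Theorems.QuarksAsStableActionCriticalLineDiamagnetismStubBilinearBounds
import Summits.QuantumFields.QCD.Theorems.QuarksAsStableActionCriticalLineDiamagnetismStubOneLoopMarginOfAux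
import Summits.QuantumFields.QCD.Theorems.QuarksAsStableActionCriticalLineDiamagnetismStubTilingCombinatorics
import Summits.QuantumFields.QCD.Theorems.QuarksAsStableActionCriticalLineDiamagnetismStubTwistCounting
import Summits.QuantumFields.QCD.Theorems.QuarksAsStableActionCriticalLineDiamagnetismStubMassLipschitz
import Summits.QuantumFields.QCD.Theorems.QuarksAsStableActionCriticalLineDiamagnetismStubWardKernel
import Summits.QuantumFields.QCD.Theorems.QuarksAsStableActionCriticalLineDiamagnetismStubBlockMargin3b
import Summits.QuantumFields.QCD.Theorems.QuarksAsStableActionCriticalLineDiamagnetismStubBlockMargin0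
import Summits.QuantumFields.QCD.Theorems.QuarksAsStableActionCriticalLineDiamagnetismStubBlockMargin1
import Summits.QuantumFields.QCD.Theorems.QuarksAsStableActionCriticalLineDiamagnetismStubBlockMargin2
import Summits.QuantumFields.QCD.Theorems.QuarksAsStableActionCriticalLineDiamagnetismStubBlockMargin3a
import Summits.QuantumFields.QCD.Theorems.QuarksAsStableActionCriticalLineDiamagnetismStubGaugeCoercive
import Summits.QuantumFields.QCD.Theorems.QuarksAsStableActionCriticalLineDiamagnetismHessianMarginOfStubsAux
import Summits.QuantumFields.QCD.Theorems.QuarksAsStableActionCriticalLineDiamagnetismStubCornerCounting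
import Summits.QuantumFields.QCD.Theorems.QuarksAsStableActionCriticalLineDiamagnetismHessianMarginOfStubsAux2
import Summits.QuantumFields.QCD.Theorems.QuarksAsStableActionCriticalLineDiamagnetismStubOneLoopMargin
import Summits.QuantumFields.QCD.Theorems.QuarksAsStableActionCriticalLineDiamagnetismEvenHalfDefs

/-!
# The EVEN HALF of the crux `CriticalLineDiamagnetism` (crux stmt-QuantumFields-9734, line `Sketch`, lead c3)

What. `stub_evenHalf`: the crux statement `Summit.QuantumFields.QCD.Theses.QuarksAsStableAction.CriticalLineDiamagnetism`
with `Even L →` inserted — for all sufficiently large EVEN tori, at `|m| ≤ ε`, the antiperiodic Wilson determinant of any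
`SU(3)` field is bounded by `exp(K − c₁ Σ_{small defects} dfc + C·#{large defects})` times the free one.

How. The skeleton's composition, now entirely over tree theorems: cell gain (`cellGain_of_stubs`: `stub_cellGain_of_gauged`
∘ `stub_cellGainTilingGlue` ∘ `stub_cellRegauge` ∘ `stub_cellGainCore` ∘ the one-loop margin `stub_oneLoopMargin`
(`…StubOneLoopMargin.lean`, which rests on `stub_hessianMargin` and hence on the certified block margins)), bad cells by Hadamard
(`stub_hadamardUpper`, free determinant from below by `stub_freeDetFormula` + `stub_freeSymbolSum`), bookkeeping by
`stub_cellIncidence`, and the `L⁴`-th root (`stub_reduction`'s chessboard side). The ODD half (`Odd L`) has no engine in this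
line; with the planner's restatement of the crux to even `L` this theorem closes it. Computational (inherits `native_decide`).
-/

noncomputable section

open scoped BigOperators Classical Matrix ComplexConjugate
open Finset
open Literature.MathematicalPhysics.QuantumLattice Literature.MathematicalPhysics.QuantumFieldTheory
  Literature.Probability.LatticeModels

namespace Summit.QuantumFields.QCD.Cruxes.CriticalLineDiamagnetism.ChessboardCellGain

/-- Stub 2 of v1/v2 (`cellGain`), verbatim, DERIVED from 2a, 3g, 3h, 3z (landed) and P6. -/
theorem cellGain_of_stubs :
    ∃ δ₀ c K₀ ε : ℝ, 0 < δ₀ ∧ 0 < c ∧ 0 < ε ∧ ∃ L₀ : ℕ, ∀ (L : ℕ) [NeZero L], Even L → L₀ ≤ L →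
    let dAP : GaugeConfig 4 L (Matrix.unitaryGroup (Fin 3) ℂ) → ℝ → ℂ := fun V m =>
      (wilsonDirac (unitaryFundamentalRep (Fin 3) ℂ)
        (fun e => if (e.1 e.2).val + 1 = L then -V e else V e) m 1).det;
    let tile : Site 4 L → GaugeConfig 4 L (Matrix.unitaryGroup (Fin 3) ℂ) →
        GaugeConfig 4 L (Matrix.unitaryGroup (Fin 3) ℂ) := fun c V e =>
      if (e.1 e.2 - c e.2).val % 2 = 0 then V (fun ν => c ν + (((e.1 ν - c ν).val % 2 : ℕ) : ZMod L), e.2)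
      else (V (fun ν => c ν + (((Site.shift e.1 e.2 ν - c ν).val % 2 : ℕ) : ZMod L), e.2))⁻¹;
    let dfc : GaugeConfig 4 L (Matrix.unitaryGroup (Fin 3) ℂ) → Plaquette 4 L → ℝ := fun V p =>
      3 - (unitaryFundamentalRep (Fin 3) ℂ (plaquetteHolonomy V p.1 p.2.1.1 p.2.1.2)).trace.re;
    let inCell : Site 4 L → Plaquette 4 L → Prop := fun c p =>
      p.1 p.2.1.1 = c p.2.1.1 ∧ p.1 p.2.1.2 = c p.2.1.2 ∧
        ∀ ν, ν ≠ p.2.1.1 → ν ≠ p.2.1.2 → (p.1 ν = c ν ∨ p.1 ν = c ν + 1);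
    ∀ (V : GaugeConfig 4 L (Matrix.unitaryGroup (Fin 3) ℂ)) (cell : Site 4 L) (m : ℝ), |m| ≤ ε →
      (∀ p, inCell cell p → dfc V p < δ₀) →
        (dAP (tile cell V) m).re ≤
          Real.exp (K₀ - c * ((L : ℝ) ^ 4 / 4) * ∑ p ∈ univ.filter (fun p => inCell cell p), dfc V p) *
            ‖dAP 1 m‖ :=
  stub_cellGain_of_gauged
    (stub_cellGainTilingGlue (stub_cellRegauge (stub_cellGainCore stub_oneLoopMargin)))


/-- **The even half of the crux** (registered helper `stub_evenHalf`): the crux statement with `Even L →` inserted. -/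
theorem stub_evenHalf : ∃ ε δ c₁ K C : ℝ, 0 < ε ∧ 0 < δ ∧ 0 < c₁ ∧ ∃ L₀ : ℕ, ∀ (L : ℕ) [NeZero L], Even L → L₀ ≤ L → let apDet : Literature.MathematicalPhysics.QuantumFieldTheory.GaugeConfig 4 L (Matrix.specialUnitaryGroup (Fin 3) ℂ) → ℝ → ℂ := fun U m => Literature.MathematicalPhysics.QuantumLattice.fermionDet (Literature.MathematicalPhysics.QuantumLattice.wilsonDirac (Literature.MathematicalPhysics.QuantumLattice.unitaryFundamentalRep (Fin 3) ℂ) (fun e => if e.1 e.2 = -1 then -(⟨(U e).1, Matrix.specialUnitaryGroup_le_unitaryGroup (U e).2⟩ : Matrix.unitaryGroup (Fin 3) ℂ) else ⟨(U e).1, Matrix.specialUnitaryGroup_le_unitaryGroup (U e).2⟩) m 1); let dfc : Literature.MathematicalPhysics.QuantumFieldTheory.GaugeConfig 4 L (Matrix.specialUnitaryGroup (Fin 3) ℂ) → Literature.MathematicalPhysics.QuantumFieldTheory.Plaquette 4 L → ℝ := fun U p => 3 - (Literature.MathematicalPhysics.QuantumLattice.fundamentalRep (Fin 3) (Literature.MathematicalPhysics.QuantumFieldTheory.plaquetteHolonomy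 U p.1 p.2.1.1 p.2.1.2)).trace.re; ∀ m : ℝ, |m| ≤ ε → ∀ U : Literature.MathematicalPhysics.QuantumFieldTheory.GaugeConfig 4 L (Matrix.specialUnitaryGroup (Fin 3) ℂ), ‖apDet U m‖ ≤ Real.exp (K - c₁ * (∑ p ∈ Finset.univ.filter (fun p => dfc U p < δ), dfc U p) + C * ((Finset.univ.filter (fun p => δ ≤ dfc U p)).card : ℝ)) * ‖apDet 1 m‖ := by
  obtain ⟨δ₀, cg, K₀, ε₁, hδ₀, hcg, hε₁, L₁, hGain⟩ := cellGain_of_stubs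
  obtain ⟨h₁, hHad⟩ := stub_hadamardUpper
  obtain ⟨h₂, ε₂, hε₂, L₂, hSym⟩ := stub_freeSymbolSum
  set H₁ : ℝ := max h₁ 0 with hH₁
  set H₂ : ℝ := max h₂ 0 with hH₂
  have hH₁0 : 0 ≤ H₁ := le_max_right _ _
  have hH₂0 : 0 ≤ H₂ := le_max_right _ _
  refine ⟨min ε₁ (min ε₂ (1 / 2)), δ₀, cg, |K₀|, 4 * (H₁ + H₂) + 144 * cg, lt_min hε₁ (lt_min hε₂ (by norm_num)),
    hδ₀, hcg, max (max L₁ L₂) 4, ?_⟩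
  intro L _ hLeven hL apDet dfc m hm U
  show ‖cruxDet U m‖ ≤ Real.exp (|K₀| - cg * (∑ p ∈ Finset.univ.filter (fun p => cruxDfc U p < δ₀), cruxDfc U p) +
    (4 * (H₁ + H₂) + 144 * cg) * ((Finset.univ.filter (fun p => δ₀ ≤ cruxDfc U p)).card : ℝ)) * ‖cruxDet 1 m‖
  -- the constants in range
  have hL₁ : L₁ ≤ L := le_trans (le_trans (le_max_left _ _) (le_max_left _ _)) hL
  have hL₂ : L₂ ≤ L := le_trans (le_trans (le_max_right _ _) (le_max_left _ _)) hL
  have hL4 : 4 ≤ L := le_trans (le_max_right _ _) hL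
  have hL2 : 2 ≤ L := le_trans (by norm_num) hL4
  have hm₁ : |m| ≤ ε₁ := le_trans hm (min_le_left _ _)
  have hm₂ : |m| ≤ ε₂ := le_trans hm (le_trans (min_le_right _ _) (min_le_left _ _))
  have hmhalf : |m| ≤ 1 / 2 := le_trans hm (le_trans (min_le_right _ _) (min_le_right _ _))
  have hm1 : |m| ≤ 1 := le_trans hmhalf (by norm_num)
  have hmneg : -1 < m := by
    have := neg_abs_le m
    linarith
  -- the U(3)-side field and the stubs at this `L`
  set V : GaugeConfig 4 L (Matrix.unitaryGroup (Fin 3) ℂ) := unitaryLift U with hV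
  have hG : ∀ (W : GaugeConfig 4 L (Matrix.unitaryGroup (Fin 3) ℂ)) (c : Site 4 L) (m' : ℝ), |m'| ≤ ε₁ →
      (∀ p, inCell c p → dfc3 W p < δ₀) →
        (dAP3 (tile3 c W) m').re ≤
          Real.exp (K₀ - cg * ((L : ℝ) ^ 4 / 4) * ∑ p ∈ univ.filter (fun p => inCell c p), dfc3 W p) * ‖dAP3 1 m'‖ :=
    fun W c m' hm' hgood => hGain L hLeven hL₁ W c m' hm' hgood
  have hH : ∀ (W : GaugeConfig 4 L (Matrix.unitaryGroup (Fin 3) ℂ)) (m' : ℝ), |m'| ≤ 1 →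
      ‖dAP3 W m'‖ ≤ Real.exp (h₁ * (L : ℝ) ^ 4) := fun W m' hm' => hHad L W m' hm'
  have hQC := stub_quarkChessboard_of_schwarz stub_backgroundSchwarz 3 L hLeven hL4 V m hmneg
  simp only [] at hQC
  obtain ⟨hReal', hChess'⟩ := hQC
  have hReal : ∀ c : Site 4 L, 0 ≤ (dAP3 (tile3 c V) m).re := fun c => (hReal' c).1
  have hChess : ‖dAP3 V m‖ ^ (L ^ 4) ≤ ∏ c : Site 4 L, (dAP3 (tile3 c V) m).re := hChess'
  have hInc := stub_cellIncidence L hL2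
  simp only [] at hInc
  obtain ⟨hCellCard', hFour'⟩ := hInc
  have hCellCard : ∀ c : Site 4 L, (univ.filter (fun p => inCell c p)).card ≤ 24 := fun c => hCellCard' c
  have hFour : ∀ p : Plaquette 4 L, (univ.filter (fun c => inCell c p)).card = 4 := fun p => hFour' p
  -- the free determinant from below
  set F : ℝ := ‖dAP3 (1 : GaugeConfig 4 L (Matrix.unitaryGroup (Fin 3) ℂ)) m‖ with hF
  have hFprod : F = ∏ k : Site 4 L,
        ((m + ∑ μ : Fin 4, (1 - Real.cos ((2 * ((k μ).val : ℝ) + 1) * Real.pi / L))) ^ 2 +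
            ∑ μ : Fin 4, Real.sin ((2 * ((k μ).val : ℝ) + 1) * Real.pi / L) ^ 2) ^ 6 := by
    have hsq : F ^ 2 = ∏ k : Site 4 L,
        ((m + ∑ μ : Fin 4, (1 - Real.cos ((2 * ((k μ).val : ℝ) + 1) * Real.pi / L))) ^ 2 +
            ∑ μ : Fin 4, Real.sin ((2 * ((k μ).val : ℝ) + 1) * Real.pi / L) ^ 2) ^ 12 :=
      stub_freeDetFormula L m
    have hP0 : 0 ≤ ∏ k : Site 4 L,
        ((m + ∑ μ : Fin 4, (1 - Real.cos ((2 * ((k μ).val : ℝ) + 1) * Real.pi / L))) ^ 2 +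
            ∑ μ : Fin 4, Real.sin ((2 * ((k μ).val : ℝ) + 1) * Real.pi / L) ^ 2) ^ 6 :=
      Finset.prod_nonneg fun k _ => by positivity
    refine (pow_left_inj₀ (norm_nonneg _) hP0 two_ne_zero).1 ?_
    rw [hsq, ← Finset.prod_pow]
    refine Finset.prod_congr rfl fun k _ => ?_
    ring
  have hFlow : Real.exp (-(H₂ * (L : ℝ) ^ 4)) ≤ F := by
    calc Real.exp (-(H₂ * (L : ℝ) ^ 4)) ≤ Real.exp (-(h₂ * (L : ℝ) ^ 4)) := by
          apply Real.exp_le_exp.2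
          have : h₂ * (L : ℝ) ^ 4 ≤ H₂ * (L : ℝ) ^ 4 :=
            mul_le_mul_of_nonneg_right (le_max_left _ _) (by positivity)
          linarith
      _ ≤ F := by rw [hFprod]; exact hSym L hL₂ m hm₂
  have hFpos : 0 < F := lt_of_lt_of_le (Real.exp_pos _) hFlow
  -- cellwise bound
  have hcell : ∀ c, (dAP3 (tile3 c V) m).re ≤ Real.exp (cellExp K₀ cg (H₁ + H₂) δ₀ V c) * F := by
    intro c
    by_cases hg : goodCell δ₀ V c
    · have h := hG V c m hm₁ hg
      simp only [cellExp, if_pos hg]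
      exact h
    · simp only [cellExp, if_neg hg]
      calc (dAP3 (tile3 c V) m).re ≤ ‖dAP3 (tile3 c V) m‖ := Complex.re_le_norm _
        _ ≤ Real.exp (h₁ * (L : ℝ) ^ 4) := hH (tile3 c V) m hm1
        _ ≤ Real.exp (H₁ * (L : ℝ) ^ 4) :=
          Real.exp_le_exp.2 (mul_le_mul_of_nonneg_right (le_max_left _ _) (by positivity))
        _ = Real.exp (H₁ * (L : ℝ) ^ 4) * (Real.exp (H₂ * (L : ℝ) ^ 4) * Real.exp (-(H₂ * (L : ℝ) ^ 4))) := by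
          rw [← Real.exp_add, add_neg_cancel, Real.exp_zero, mul_one]
        _ ≤ Real.exp (H₁ * (L : ℝ) ^ 4) * (Real.exp (H₂ * (L : ℝ) ^ 4) * F) := by
          gcongr
        _ = Real.exp ((H₁ + H₂) * (L : ℝ) ^ 4) * F := by
          rw [add_mul, Real.exp_add]; ring
  -- product over cells
  have hprod : ∏ c : Site 4 L, (dAP3 (tile3 c V) m).re ≤
      Real.exp (∑ c : Site 4 L, cellExp K₀ cg (H₁ + H₂) δ₀ V c) * F ^ (L ^ 4) := by
    calc ∏ c : Site 4 L, (dAP3 (tile3 c V) m).re ≤ ∏ c : Site 4 L, (Real.exp (cellExp K₀ cg (H₁ + H₂) δ₀ V c) * F) :=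
          Finset.prod_le_prod (fun c _ => hReal c) (fun c _ => hcell c)
      _ = Real.exp (∑ c : Site 4 L, cellExp K₀ cg (H₁ + H₂) δ₀ V c) * F ^ (L ^ 4) := by
          rw [Finset.prod_mul_distrib, Real.exp_sum, Finset.prod_const, Finset.card_univ, card_site]
  -- the exponent estimate
  set E : ℝ := |K₀| - cg * (∑ p ∈ univ.filter (fun p => dfc3 V p < δ₀), dfc3 V p) +
      (4 * (H₁ + H₂) + 144 * cg) * ((univ.filter (fun p => δ₀ ≤ dfc3 V p)).card : ℝ) with hE
  have hex : ∑ c : Site 4 L, cellExp K₀ cg (H₁ + H₂) δ₀ V c ≤ (L : ℝ) ^ 4 * E :=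
    sum_cellExp_le K₀ cg (H₁ + H₂) δ₀ hcg.le (add_nonneg hH₁0 hH₂0) V hCellCard hFour
  -- assemble: L⁴-th power, then root
  have hpow : ‖dAP3 V m‖ ^ (L ^ 4) ≤ (Real.exp E * F) ^ (L ^ 4) := by
    calc ‖dAP3 V m‖ ^ (L ^ 4) ≤ ∏ c : Site 4 L, (dAP3 (tile3 c V) m).re := hChess
      _ ≤ Real.exp (∑ c : Site 4 L, cellExp K₀ cg (H₁ + H₂) δ₀ V c) * F ^ (L ^ 4) := hprod
      _ ≤ Real.exp ((L : ℝ) ^ 4 * E) * F ^ (L ^ 4) := by gcongr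
      _ = (Real.exp E * F) ^ (L ^ 4) := by
          rw [mul_pow, ← Real.exp_nat_mul]; push_cast; ring_nf
  have hL40 : L ^ 4 ≠ 0 := pow_ne_zero 4 (NeZero.ne L)
  have hroot : ‖dAP3 V m‖ ≤ Real.exp E * F :=
    (pow_le_pow_iff_left₀ (norm_nonneg _) (by positivity) hL40).1 hpow
  -- back to the crux's notation
  have hdfc : ∀ p, cruxDfc U p = dfc3 V p := fun p => by rw [hV]; exact cruxDfc_eq U p
  simp only [hdfc]
  rw [cruxDet_eq, cruxDet_one, ← hV]
  exact hroot

end Summit.QuantumFields.QCD.Cruxes.CriticalLineDiamagnetism.ChessboardCellGain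

end
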